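import Summits.Ventures.PercRepro.C025ProfileStagedBounds

/-!
# SESSION 4 — THE ONE-COLOOP TOOLBOX AND THE ABSORPTION LEMMA FOR THEOREM L3 (night-3 g12; proofs/NIGHT3-G12-LINE3.md §3)
General facts (no hypothesis on the lines): the plane of an `Ls`-demander of `S` is the plane of `S ∖ x` (`clF_erase_erase_eq_of_mem_lsPairs`);
`rigid S ≤ #dcol S + Σ_{Ls} 1/|F_B|` (`rigid_le_card_dcol_add_sum_inv_outer`); with a single coloop `x`, every `Ls`-pair is `(y, x)`,
`y ∈ S ∖ x`, so **`rigid S ≤ 1 + |S ∖ x| / |F_{S∖x}|`** (`rigid_le_one_add_of_coloops_eq_singleton`, (4.1) of LINE3) and `rigid S ≤ 4`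
when `|S ∖ x| ≤ 3 |F_{S∖x}|` (`rigid_le_four_of_coloops_eq_singleton_of_card_le`, Lemma 4); **absorption** (Lemma 5's mechanism):
`#dcol (B ∪ x) = 1` and `rigid (B ∪ x) ≤ 4 − jsh B` force `ovf B x = 0` (`ovf_eq_zero_of_rigid_le`). Also `j_B ≤ 3` (`jB_le_three`).
-/
open scoped Matroid
namespace PercRepro
open Set Finset ThmH
namespace Staged
variable {α : Type} [DecidableEq α] {M : Matroid α} [M.Finite]

omit [DecidableEq α] in
/-- `clF` is monotone. -/
theorem clF_mono {X Y : Finset α} (h : X ⊆ Y) : clF M X ⊆ clF M Y := by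
  intro a ha
  have h1 : a ∈ ((clF M X : Finset α) : Set α) := Finset.mem_coe.mpr ha
  rw [coe_clF] at h1
  have h2 : a ∈ M.closure (Y : Set α) := M.closure_subset_closure (Finset.coe_subset.mpr h) h1
  rw [← coe_clF] at h2
  exact Finset.mem_coe.mp h2

omit [DecidableEq α] in
/-- `clF X ⊆ clF Y` as soon as `X ⊆ clF Y`. -/
theorem clF_subset_clF_of_subset_clF {X Y : Finset α} (h : X ⊆ clF M Y) : clF M X ⊆ clF M Y := by
  intro a ha
  have h1 : a ∈ ((clF M X : Finset α) : Set α) := Finset.mem_coe.mpr ha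
  rw [coe_clF] at h1
  have hXY : (X : Set α) ⊆ M.closure (Y : Set α) := by
    rw [← coe_clF]; exact Finset.coe_subset.mpr h
  have h2 : a ∈ M.closure (Y : Set α) := Matroid.closure_subset_closure_of_subset_closure hXY h1
  rw [← coe_clF] at h2
  exact Finset.mem_coe.mp h2

/-- **The plane of an `Ls`-demander is the plane of `S ∖ x`**: `cl(S ∖ {y, x}) = cl(S ∖ x)` for `(y, x) ∈ lsPairs S`. -/
theorem clF_erase_erase_eq_of_mem_lsPairs {S : Finset α} (hS : S ⊆ gr M) {yx : α × α}
    (h : yx ∈ lsPairs M S) : clF M ((S.erase yx.1).erase yx.2) = clF M (S.erase yx.2) := by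
  have h' := mem_lsPairs.mp h
  obtain ⟨⟨hy, _⟩, hne, _, _, hycl, _⟩ := h'
  set B := (S.erase yx.1).erase yx.2 with hB
  have hBg : B ⊆ gr M := ((Finset.erase_subset _ _).trans (Finset.erase_subset _ _)).trans hS
  have hsub : S.erase yx.2 ⊆ clF M B := by
    rw [erase_eq_insert_erase_erase hy hne, ← hB]
    exact Finset.insert_subset hycl (subset_clF_self hBg)
  have hBsub : B ⊆ S.erase yx.2 := by
    rw [hB, Finset.erase_right_comm]; exact Finset.erase_subset _ _
  exact Finset.Subset.antisymm (clF_mono hBsub) (clF_subset_clF_of_subset_clF hsub)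

/-- The outer set of an `Ls`-demander is that of `S ∖ x`. -/
theorem outer_erase_erase_eq_of_mem_lsPairs {S : Finset α} (hS : S ⊆ gr M) {yx : α × α}
    (h : yx ∈ lsPairs M S) : outer M ((S.erase yx.1).erase yx.2) = outer M (S.erase yx.2) := by
  unfold outer; rw [clF_erase_erase_eq_of_mem_lsPairs hS h]

/-- The rigid load is at most `#dcol S` plus `Σ 1/|F_B|` over the `Ls`-pairs. -/
theorem rigid_le_card_dcol_add_sum_inv_outer {S : Finset α} (hS : S ⊆ gr M) :
    rigid M S ≤ ((dcol M S).card : ℚ) +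
      ∑ yx ∈ lsPairs M S, 1 / ((outer M ((S.erase yx.1).erase yx.2)).card : ℚ) := by
  have h0 := rigid_le_card_dcol_add (M := M) (S := S)
  have hls : ∑ yx ∈ lsPairs M S, ovf M ((S.erase yx.1).erase yx.2) yx.2 /
      ((inner M ((S.erase yx.1).erase yx.2)).card : ℚ) ≤
      ∑ yx ∈ lsPairs M S, 1 / ((outer M ((S.erase yx.1).erase yx.2)).card : ℚ) := by
    apply Finset.sum_le_sum
    intro yx _
    have hBg : (S.erase yx.1).erase yx.2 ⊆ gr M :=
      ((Finset.erase_subset _ _).trans (Finset.erase_subset _ _)).trans hS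
    exact ls_term_le_inv_card_outer hBg _
  linarith

/-- With a single coloop `x`, every `Ls`-pair is `(y, x)` with `y ∈ S ∖ x`. -/
theorem lsPairs_subset_of_coloops_eq_singleton {S : Finset α} {x : α} (hS : S ⊆ gr M)
    (hk : (S.filter (fun t => rkN M (S.erase t) ≤ 3)) = {x}) : lsPairs M S ⊆ (S.erase x) ×ˢ ({x} : Finset α) := by
  intro yx hyx
  have hp := lsPairs_subset_product hS hyx
  rw [Finset.mem_product, hk, Finset.mem_singleton] at hp
  have h := mem_lsPairs.mp hyx
  rw [Finset.mem_product, Finset.mem_singleton, Finset.mem_erase]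
  exact ⟨⟨fun heq => h.2.1 (heq.trans hp.2.symm), hp.1⟩, hp.2⟩

/-- **The one-coloop bound** ((4.1) of LINE3): with a single coloop `x`, `rigid S ≤ 1 + |S ∖ x| / |F_{S ∖ x}|`. -/
theorem rigid_le_one_add_of_coloops_eq_singleton {S : Finset α} {x : α} (hS : S ⊆ gr M)
    (hk : (S.filter (fun t => rkN M (S.erase t) ≤ 3)) = {x}) :
    rigid M S ≤ 1 + ((S.erase x).card : ℚ) / ((outer M (S.erase x)).card : ℚ) := by
  have h0 := rigid_le_card_dcol_add_sum_inv_outer (M := M) hS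
  have hd : ((dcol M S).card : ℚ) ≤ 1 := by
    have h1 : (dcol M S).card ≤ 1 := by
      have := Finset.card_le_card (dcol_subset_coloops (M := M) S)
      rw [hk, Finset.card_singleton] at this; exact this
    exact_mod_cast h1
  have hsum : ∑ yx ∈ lsPairs M S, 1 / ((outer M ((S.erase yx.1).erase yx.2)).card : ℚ)
      = ∑ _yx ∈ lsPairs M S, 1 / ((outer M (S.erase x)).card : ℚ) := by
    apply Finset.sum_congr rfl
    intro yx hyx
    have h2 : yx.2 = x := by
      have := lsPairs_subset_of_coloops_eq_singleton hS hk hyx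
      rw [Finset.mem_product, Finset.mem_singleton] at this; exact this.2
    rw [outer_erase_erase_eq_of_mem_lsPairs hS hyx, h2]
  have hcard : ((lsPairs M S).card : ℚ) ≤ ((S.erase x).card : ℚ) := by
    have h1 : (lsPairs M S).card ≤ ((S.erase x) ×ˢ ({x} : Finset α)).card :=
      Finset.card_le_card (lsPairs_subset_of_coloops_eq_singleton hS hk)
    rw [Finset.card_product, Finset.card_singleton, mul_one] at h1
    exact_mod_cast h1
  rw [hsum, Finset.sum_const, nsmul_eq_mul] at h0
  have hnn : (0 : ℚ) ≤ 1 / ((outer M (S.erase x)).card : ℚ) := by positivity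
  calc rigid M S ≤ ((dcol M S).card : ℚ) + ((lsPairs M S).card : ℚ) * (1 / ((outer M (S.erase x)).card : ℚ)) := h0
    _ ≤ 1 + ((S.erase x).card : ℚ) * (1 / ((outer M (S.erase x)).card : ℚ)) :=
        add_le_add hd (mul_le_mul_of_nonneg_right hcard hnn)
    _ = 1 + ((S.erase x).card : ℚ) / ((outer M (S.erase x)).card : ℚ) := by ring

/-- **The crude one-coloop bound** (Lemma 4 of LINE3): a single coloop `x` and `|S ∖ x| ≤ 3 |F_{S ∖ x}|` give `rigid S ≤ 4`. -/
theorem rigid_le_four_of_coloops_eq_singleton_of_card_le {S : Finset α} {x : α} (hS : S ⊆ gr M)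
    (hk : (S.filter (fun t => rkN M (S.erase t) ≤ 3)) = {x}) (hc : (S.erase x).card ≤ 3 * (outer M (S.erase x)).card) :
    rigid M S ≤ 4 := by
  have h := rigid_le_one_add_of_coloops_eq_singleton hS hk
  rcases Nat.eq_zero_or_pos (outer M (S.erase x)).card with h0 | hpos
  · rw [h0, Nat.cast_zero, div_zero, add_zero] at h
    linarith
  · have hpos' : (0 : ℚ) < (outer M (S.erase x)).card := by exact_mod_cast hpos
    have hc' : ((S.erase x).card : ℚ) ≤ 3 * ((outer M (S.erase x)).card : ℚ) := by exact_mod_cast hc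
    have hdiv : ((S.erase x).card : ℚ) / ((outer M (S.erase x)).card : ℚ) ≤ 3 := by
      rw [div_le_iff₀ hpos']; linarith
    linarith

/-- **Absorption** (the mechanism of Lemma 5 of LINE3): if `B ∪ {x}` has exactly one demanding coloop-triple and
`rigid (B ∪ x) ≤ 4 − jsh B`, then `B` overflows nothing at `x`. -/
theorem ovf_eq_zero_of_rigid_le {B : Finset α} {x : α} (hd : (dcol M (insert x B)).card = 1)
    (h : rigid M (insert x B) ≤ 4 - jsh M B) : ovf M B x = 0 := by
  unfold ovf take allow allowOf
  rw [hd, Nat.cast_one, div_one]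
  have hle : jsh M B ≤ max 0 (4 - rigid M (insert x B)) := le_max_of_le_right (by linarith)
  rw [min_eq_left hle, sub_self]

/-- **The excess is at most `3`**: `j_B ≤ 3` for a rank-`3` set `B`. -/
theorem jB_le_three {B : Finset α} (h3 : rkN M B = 3) : jB M B ≤ 3 := by
  unfold jB
  have h1 : crk M B ≤ M.eRank.toNat := by
    rw [crk_eq_rkN, ← rkN_gr_eq]; exact rkN_mono (Finset.sdiff_subset)
  have h2 := eRank_toNat_le_fB_add_rkN (M := M) B
  rw [h3] at h2
  omega

/-- Every `Ls`-term is at most `jsh B / |T_B|`. -/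
theorem ls_term_le_jsh_div {B : Finset α} (x : α) :
    ovf M B x / ((inner M B).card : ℚ) ≤ jsh M B / ((inner M B).card : ℚ) := by
  apply div_le_div_of_nonneg_right _ (by positivity)
  unfold ovf; linarith [take_nonneg (M := M) B x]

/-- If no `Ls`-demander of `S` overflows, the rigid load is at most `#dcol S`. -/
theorem rigid_le_card_dcol_of_forall_ovf_eq_zero {S : Finset α}
    (h : ∀ yx ∈ lsPairs M S, ovf M ((S.erase yx.1).erase yx.2) yx.2 = 0) :
    rigid M S ≤ ((dcol M S).card : ℚ) := by
  have h0 := rigid_le_card_dcol_add (M := M) (S := S)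
  have hz : ∑ yx ∈ lsPairs M S, ovf M ((S.erase yx.1).erase yx.2) yx.2 /
      ((inner M ((S.erase yx.1).erase yx.2)).card : ℚ) = 0 := by
    apply Finset.sum_eq_zero
    intro yx hyx
    rw [h yx hyx, zero_div]
  linarith

/-- **Propagation** (the step of Lemma 7 of LINE3, abstractly): with a single coloop `x`, if every `Ls`-demander `S ∖ {y, x}` is
absorbed at `S ∖ y` (one demanding coloop-triple there and `rigid (S ∖ y) ≤ 4 − jsh`), then `rigid S ≤ 1`. -/
theorem rigid_le_one_of_coloops_eq_singleton_of_forall {S : Finset α} {x : α} (hS : S ⊆ gr M)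
    (hk : (S.filter (fun t => rkN M (S.erase t) ≤ 3)) = {x})
    (h : ∀ y ∈ S.erase x, (y, x) ∈ lsPairs M S →
      (dcol M (S.erase y)).card = 1 ∧ rigid M (S.erase y) ≤ 4 - jsh M ((S.erase y).erase x)) :
    rigid M S ≤ 1 := by
  have hd : ((dcol M S).card : ℚ) ≤ 1 := by
    have h1 : (dcol M S).card ≤ 1 := by
      have := Finset.card_le_card (dcol_subset_coloops (M := M) S)
      rw [hk, Finset.card_singleton] at this; exact this
    exact_mod_cast h1
  refine (rigid_le_card_dcol_of_forall_ovf_eq_zero ?_).trans hd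
  intro yx hyx
  have hp := lsPairs_subset_of_coloops_eq_singleton hS hk hyx
  rw [Finset.mem_product, Finset.mem_singleton] at hp
  obtain ⟨hy, hx2⟩ := hp
  have hyx' : (yx.1, x) ∈ lsPairs M S := by rw [← hx2]; exact hyx
  obtain ⟨hd1, hr⟩ := h yx.1 hy hyx'
  have hxS : x ∈ S.erase yx.1 := by
    rw [Finset.mem_erase]
    refine ⟨(Finset.mem_erase.mp hy).1.symm, ?_⟩
    have : x ∈ (S.filter (fun t => rkN M (S.erase t) ≤ 3)) := by rw [hk]; exact Finset.mem_singleton_self x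
    exact (Finset.mem_filter.mp this).1
  have hins : insert x ((S.erase yx.1).erase x) = S.erase yx.1 := Finset.insert_erase hxS
  rw [hx2]
  apply ovf_eq_zero_of_rigid_le
  · rw [hins]; exact hd1
  · rw [hins]; exact hr

end Staged
end PercRepro

/-!
# SESSION 4 (continued) — THE ONE-COLOOP SETS IN THE FORM `C ∪ {x}` (night-3 g12; proofs/NIGHT3-G12-LINE3.md §3, Lemmas 4, 5, 7)
For a coloop-free rank-`3` set `C ⊆ gr M` (every `C ∖ z` still has rank `3`) and an outer point `x ∈ F_C`: `C ∪ {x}` has the single coloop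
`x` (`coloops_insert_eq_singleton`), its only demanding coloop-triple is `C` (`dcol_insert_eq_singleton`), the planes of `C` and `C ∖ y`
coincide (`outer_erase_eq_of_rkN_erase_eq`), so `rigid (C ∪ x) ≤ 1 + |C| / |F_C|` (`rigid_insert_le_one_add`, (4.1)), and — the step of
Lemma 7 — if every demanding `C ∖ y` is coloop-free and absorbed at `(C ∖ y) ∪ x`, then `rigid (C ∪ x) ≤ 1` (`rigid_insert_le_one_of_forall`).
-/
open scoped Matroid
namespace PercRepro
open Set Finset ThmH
namespace Staged
variable {α : Type} [DecidableEq α] {M : Matroid α} [M.Finite]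

omit [DecidableEq α] in
/-- `cl X = cl Y` when `X ⊆ Y` and `ρ(Y) ≤ ρ(X)`. -/
theorem clF_eq_clF_of_subset_of_rkN_le {X Y : Finset α} (hXY : X ⊆ Y) (hr : rkN M Y ≤ rkN M X) :
    clF M X = clF M Y := by
  apply Finset.coe_inj.mp
  rw [coe_clF, coe_clF]
  apply (M.isRkFinite_set (X : Set α)).closure_eq_closure_of_subset_of_eRk_ge_eRk (Finset.coe_subset.mpr hXY)
  rw [← coe_rkN, ← coe_rkN]; exact_mod_cast hr

/-- Adding an outer point raises the rank by one. -/
theorem rkN_insert_of_mem_outer {A : Finset α} {x : α} (hx : x ∈ outer M A) :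
    rkN M (insert x A) = rkN M A + 1 := by
  rw [mem_outer] at hx
  have he : x ∈ M.E \ M.closure (A : Set α) := by
    rw [Set.mem_sdiff, ← coe_gr, ← coe_clF]
    exact ⟨by exact_mod_cast hx.1, by exact_mod_cast hx.2⟩
  have h := M.eRk_insert_eq_add_one he
  rw [← Finset.coe_insert, ← coe_rkN, ← coe_rkN] at h
  exact_mod_cast h

/-- The outer set of `C ∖ y` is that of `C` when the rank does not drop. -/
theorem outer_erase_eq_of_rkN_erase_eq {C : Finset α} {y : α} (h : rkN M (C.erase y) = rkN M C) :
    outer M (C.erase y) = outer M C := by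
  unfold outer
  rw [clF_eq_clF_of_subset_of_rkN_le (Finset.erase_subset y C) h.ge]

/-- An outer point of `C` is not in `C` (`C ⊆ gr M`). -/
theorem notMem_of_mem_outer {C : Finset α} {x : α} (hCg : C ⊆ gr M) (hx : x ∈ outer M C) : x ∉ C :=
  fun h => (mem_outer.mp hx).2 (subset_clF_self hCg h)

/-- **`C ∪ {x}` has the single coloop `x`** for `C ⊆ gr M` coloop-free of rank `3` and `x ∈ F_C`. -/
theorem coloops_insert_eq_singleton {C : Finset α} {x : α} (hCg : C ⊆ gr M) (hC3 : rkN M C = 3)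
    (hfree : ∀ z ∈ C, rkN M (C.erase z) = 3) (hx : x ∈ outer M C) :
    ((insert x C).filter (fun t => rkN M ((insert x C).erase t) ≤ 3)) = {x} := by
  have hxC : x ∉ C := notMem_of_mem_outer hCg hx
  ext z
  rw [Finset.mem_filter, Finset.mem_singleton, Finset.mem_insert]
  constructor
  · rintro ⟨hz, hr⟩
    by_contra hzx
    have hzC : z ∈ C := by
      rcases hz with h | h
      · exact absurd h hzx
      · exact h
    have hne : x ≠ z := fun h => hzx h.symm
    rw [Finset.erase_insert_of_ne hne] at hr
    have hx' : x ∈ outer M (C.erase z) := by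
      rw [outer_erase_eq_of_rkN_erase_eq (by rw [hfree z hzC, hC3])]; exact hx
    rw [rkN_insert_of_mem_outer hx', hfree z hzC] at hr
    omega
  · rintro rfl
    refine ⟨Or.inl rfl, ?_⟩
    rw [Finset.erase_insert hxC, hC3]

/-- **`C ∪ {x}` has the single demanding coloop-triple `C`** when moreover `C` is demanding. -/
theorem dcol_insert_eq_singleton {C : Finset α} {x : α} (hCg : C ⊆ gr M) (hC3 : rkN M C = 3)
    (hfree : ∀ z ∈ C, rkN M (C.erase z) = 3) (hd : 4 ≤ crk M C) (hx : x ∈ outer M C) :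
    dcol M (insert x C) = {x} := by
  have hxC : x ∉ C := notMem_of_mem_outer hCg hx
  ext z
  rw [mem_dcol, Finset.mem_singleton, Finset.mem_insert]
  constructor
  · rintro ⟨hz, hr, _⟩
    by_contra hzx
    have hzC : z ∈ C := by
      rcases hz with h | h
      · exact absurd h hzx
      · exact h
    have hne : x ≠ z := fun h => hzx h.symm
    rw [Finset.erase_insert_of_ne hne] at hr
    have hx' : x ∈ outer M (C.erase z) := by
      rw [outer_erase_eq_of_rkN_erase_eq (by rw [hfree z hzC, hC3])]; exact hx
    rw [rkN_insert_of_mem_outer hx', hfree z hzC] at hr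
    omega
  · rintro rfl
    refine ⟨Or.inl rfl, ?_, ?_⟩
    · rw [Finset.erase_insert hxC, hC3]
    · rw [Finset.erase_insert hxC]; exact hd

/-- **(4.1) in the form `C ∪ {x}`**: `rigid (C ∪ x) ≤ 1 + |C| / |F_C|` for `C ⊆ gr M` coloop-free of rank `3`, `x ∈ F_C`. -/
theorem rigid_insert_le_one_add {C : Finset α} {x : α} (hCg : C ⊆ gr M) (hC3 : rkN M C = 3)
    (hfree : ∀ z ∈ C, rkN M (C.erase z) = 3) (hx : x ∈ outer M C) :
    rigid M (insert x C) ≤ 1 + (C.card : ℚ) / ((outer M C).card : ℚ) := by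
  have hxC : x ∉ C := notMem_of_mem_outer hCg hx
  have hSg : insert x C ⊆ gr M := Finset.insert_subset (mem_outer.mp hx).1 hCg
  have h := rigid_le_one_add_of_coloops_eq_singleton hSg (coloops_insert_eq_singleton hCg hC3 hfree hx)
  rw [Finset.erase_insert hxC] at h
  exact h

/-- **Lemma 4 in the form `C ∪ {x}`**: `|C| ≤ 3 |F_C|` gives `rigid (C ∪ x) ≤ 4`. -/
theorem rigid_insert_le_four_of_card_le {C : Finset α} {x : α} (hCg : C ⊆ gr M) (hC3 : rkN M C = 3)
    (hfree : ∀ z ∈ C, rkN M (C.erase z) = 3) (hx : x ∈ outer M C) (hc : C.card ≤ 3 * (outer M C).card) :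
    rigid M (insert x C) ≤ 4 := by
  have hxC : x ∉ C := notMem_of_mem_outer hCg hx
  have hSg : insert x C ⊆ gr M := Finset.insert_subset (mem_outer.mp hx).1 hCg
  apply rigid_le_four_of_coloops_eq_singleton_of_card_le hSg (coloops_insert_eq_singleton hCg hC3 hfree hx)
  rw [Finset.erase_insert hxC]; exact hc

/-- **The step of Lemma 7** in the form `C ∪ {x}`: if every demanding `C ∖ y` is coloop-free and
`rigid ((C ∖ y) ∪ x) ≤ 4 − jsh (C ∖ y)`, then `rigid (C ∪ x) ≤ 1`. -/
theorem rigid_insert_le_one_of_forall {C : Finset α} {x : α} (hCg : C ⊆ gr M) (hC3 : rkN M C = 3)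
    (hfree : ∀ z ∈ C, rkN M (C.erase z) = 3) (hx : x ∈ outer M C)
    (h : ∀ y ∈ C, 4 ≤ crk M (C.erase y) →
      (∀ z ∈ C.erase y, rkN M ((C.erase y).erase z) = 3) ∧
        rigid M (insert x (C.erase y)) ≤ 4 - jsh M (C.erase y)) :
    rigid M (insert x C) ≤ 1 := by
  have hxC : x ∉ C := notMem_of_mem_outer hCg hx
  have hSg : insert x C ⊆ gr M := Finset.insert_subset (mem_outer.mp hx).1 hCg
  apply rigid_le_one_of_coloops_eq_singleton_of_forall hSg (coloops_insert_eq_singleton hCg hC3 hfree hx)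
  intro y hy hyx
  rw [Finset.erase_insert hxC] at hy
  have hne : x ≠ y := fun h => hxC (h ▸ hy)
  have hE1 : (insert x C).erase y = insert x (C.erase y) := Finset.erase_insert_of_ne hne
  have hxCy : x ∉ C.erase y := fun h => hxC (Finset.mem_of_mem_erase h)
  have hE2 : ((insert x C).erase y).erase x = C.erase y := by rw [hE1, Finset.erase_insert hxCy]
  have hdem : 4 ≤ crk M (C.erase y) := by
    have := (mem_lsPairs.mp hyx).2.2.2.1
    simpa only [hE2] using this
  obtain ⟨hfree', hr⟩ := h y hy hdem
  have hx' : x ∈ outer M (C.erase y) := by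
    rw [outer_erase_eq_of_rkN_erase_eq (by rw [hfree y hy, hC3])]; exact hx
  have hCyg : C.erase y ⊆ gr M := (Finset.erase_subset _ _).trans hCg
  refine ⟨?_, ?_⟩
  · rw [hE1, dcol_insert_eq_singleton hCyg (hfree y hy) hfree' hdem hx', Finset.card_singleton]
  · rw [hE1, Finset.erase_insert hxCy]; exact hr

end Staged
end PercRepro
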